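import Summits.CriticalPhenomena.PercolationContinuityZ3.Theorems.PercRayRenewalJumpLineAvoidanceDecayPalmStationarity
import HarnessLib

/-!
# Crux `PercRayRenewal.JumpLineAvoidanceDecay` (stmt-CriticalPhenomena-4626) — Palm form, part 2: the equivalence

Helper file of the line `registered` (lead c5 of the crux chain, 2026-08-17); lands with
`--supports stmt-CriticalPhenomena-4626` (registered stub `palmDecay_of_jumpLineAvoidanceDecay`).

With `e_m = P_{p_c}(e₀ ↮ ∞, …, m e₀ ↮ ∞)` and `u_m = P_{p_c}(0 ↔ ∞, e₀ ↮ ∞, …, m e₀ ↮ ∞)` as in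
part 1 (`PercRayRenewalJumpLineAvoidanceDecayPalmStationarity.lean`: `u_m = e_m - e_{m+1}`, the Kac
bound `(m+1) u_m ≤ 1`, `e_m → 0` in the jump world):

* `palmDecay_of_jumpLineAvoidanceDecay` — **G ⇒ Palm decay**: `e_m ≤ C m^{-κ}` (`m ≥ 1`) gives
  `u_m ≤ C 2^{1+κ} m^{-(1+κ)}` (`(m - m' + 1) u_m ≤ u_{m'} + ⋯ + u_m = e_{m'} - e_{m+1} ≤ C m'^{-κ}`
  with `m' = ⌈m/2⌉`);
* `jumpLineAvoidanceDecay_of_palmDecay` — **Palm decay ⇒ G**: `u_m ≤ C m^{-(1+κ)}` gives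
  `e_m ≤ C (1 + 1/κ) m^{-κ}` (`e_m = (u_m + ⋯ + u_{m+n-1}) + e_{m+n}`, the sum–integral comparison
  `sum_rpow_neg_le` for `x ↦ x^{-(1+κ)}`, and `e_{m+n} → 0` by ergodicity);
* `jumpLineAvoidanceDecay_iff_palmDecay` — **the Palm form of the crux**:
  `JumpLineAvoidanceDecay ↔ (0 < θ(p_c) → ∃ κ > 0, C, ∀ m ≥ 1, u_m ≤ C m^{-(1+κ)})`.

So the crux asks EXACTLY to improve the free stationarity rate `u_m ≤ 1/(m+1)` of part 1 by a
power, i.e. for a Palm gap moment `E⁰[T^{1+κ'}] < ∞` of the point process of axis sites in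
infinite clusters; Kozma–Nitzan (arXiv:2401.12397, p. 2 item 4, "les Diablerets 2012",
unpublished) record that Barsky–Grimmett–Newman forces `Σ_m m u_m = ∞` in the jump world, so
`κ ≤ 1` there. No percolation estimate is proved in this file.

## References

* G. Kozma, S. Nitzan, *A reduction of the θ(p_c) = 0 problem to a conjectured inequality*,
  arXiv:2401.12397 (2024), p. 2 items 4–5 [KozmaNitzan2024].
* G. Grimmett, *Percolation*, 2nd ed., Springer 1999, §1.6, §7.3 p. 165 [Grimmett1999].
-/

noncomputable section

namespace Summit.CriticalPhenomena.PercolationContinuityZ3.Theorems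

open MeasureTheory Filter Topology Literature.Probability.Percolation Literature.Probability.LatticeModels

namespace JumpLineAvoidanceDecayPalm

/-! ## §4 Analysis: the tail of `Σ j^{-(1+κ)}` -/

/-- **Tail of the `(1+κ)`-series**: for `κ > 0`, `m ≥ 1` and every `n`,
`Σ_{j < n} (m + j)^{-(1+κ)} ≤ (1 + 1/κ) m^{-κ}` (the `j = 0` term is `≤ m^{-κ}`; the others are
compared with `∫_m^{m+n-1} x^{-(1+κ)} dx ≤ m^{-κ}/κ`). [folklore] -/
theorem sum_rpow_neg_le {κ : ℝ} (hκ : 0 < κ) {m : ℕ} (hm : 1 ≤ m) (n : ℕ) :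
    ∑ j ∈ Finset.range n, ((m : ℝ) + j) ^ (-(1 + κ)) ≤ (1 + 1 / κ) * (m : ℝ) ^ (-κ) := by
  have hm0 : (0 : ℝ) < m := by exact_mod_cast hm
  have hm1 : (1 : ℝ) ≤ m := by exact_mod_cast hm
  have hmκ : 0 < (m : ℝ) ^ (-κ) := Real.rpow_pos_of_pos hm0 _
  rcases n with _ | n
  · simp only [Finset.range_zero, Finset.sum_empty]
    positivity
  rw [Finset.sum_range_succ']
  simp only [Nat.cast_add, Nat.cast_one, CharP.cast_eq_zero, add_zero]
  -- the `j = 0` term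
  have h0 : (m : ℝ) ^ (-(1 + κ)) ≤ (m : ℝ) ^ (-κ) :=
    Real.rpow_le_rpow_of_exponent_le hm1 (by linarith)
  -- the other terms: sum–integral comparison for the antitone `x ↦ x^{-(1+κ)}` on `[m, m+n]`
  set f : ℝ → ℝ := fun x => x ^ (-(1 + κ)) with hf
  have hanti : AntitoneOn f (Set.Icc (m : ℝ) ((m : ℝ) + n)) := by
    intro x hx y _ hxy
    have hx0 : 0 < x := hm0.trans_le hx.1
    exact Real.rpow_le_rpow_of_nonpos hx0 hxy (by linarith)
  have hcmp : ∑ i ∈ Finset.range n, f ((m : ℝ) + ((i + 1 : ℕ) : ℝ)) ≤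
      ∫ x in (m : ℝ)..(m : ℝ) + n, f x := AntitoneOn.sum_le_integral hanti
  have hsum_eq : ∑ i ∈ Finset.range n, ((m : ℝ) + ((i : ℝ) + 1)) ^ (-(1 + κ)) =
      ∑ i ∈ Finset.range n, f ((m : ℝ) + ((i + 1 : ℕ) : ℝ)) := by
    refine Finset.sum_congr rfl fun i _ => ?_
    simp only [hf, Nat.cast_add, Nat.cast_one]
  have hint : ∫ x in (m : ℝ)..(m : ℝ) + n, f x ≤ (m : ℝ) ^ (-κ) / κ := by
    have hne : (-(1 + κ)) ≠ -1 := by intro h; linarith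
    have hmn : (m : ℝ) ≤ (m : ℝ) + n := le_add_of_nonneg_right (Nat.cast_nonneg n)
    have h0notin : (0 : ℝ) ∉ Set.uIcc (m : ℝ) ((m : ℝ) + n) := by
      rw [Set.uIcc_of_le hmn]
      intro h
      exact absurd h.1 (not_le.2 hm0)
    have hI := integral_rpow (a := (m : ℝ)) (b := (m : ℝ) + n) (Or.inr ⟨hne, h0notin⟩)
    show ∫ x in (m : ℝ)..(m : ℝ) + n, x ^ (-(1 + κ)) ≤ (m : ℝ) ^ (-κ) / κ
    rw [hI]
    have e : -(1 + κ) + 1 = -κ := by ring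
    rw [e, div_neg, ← neg_div, neg_sub]
    have hb : 0 ≤ ((m : ℝ) + n) ^ (-κ) := Real.rpow_nonneg (by positivity) _
    exact div_le_div_of_nonneg_right (by linarith) hκ.le
  have hfin : (m : ℝ) ^ (-κ) / κ + (m : ℝ) ^ (-κ) = (1 + 1 / κ) * (m : ℝ) ^ (-κ) := by
    field_simp
    ring
  rw [hsum_eq]
  linarith

end JumpLineAvoidanceDecayPalm

open JumpLineAvoidanceDecayPalm

/-! ## §5 The Palm form of the crux -/

/-- **G ⇒ Palm decay.** If `e_m ≤ C m^{-κ}` (`m ≥ 1`) then `u_m ≤ C 2^{1+κ} m^{-(1+κ)}`: with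
`m' = ⌈m/2⌉` and `n = m - m' + 1`, antitonicity and telescoping give
`n u_m ≤ u_{m'} + ⋯ + u_m = e_{m'} - e_{m+1} ≤ C m'^{-κ}`, and `m' ≥ m/2`, `n ≥ m/2`. [folklore] -/
theorem palmDecay_of_jumpLineAvoidanceDecay
    (hG : Summit.CriticalPhenomena.PercolationContinuityZ3.Theses.PercRayRenewal.JumpLineAvoidanceDecay)
    (hθ : 0 < theta (zdGraph 3) (0 : Site 3) (criticalProbI 3)) :
    ∃ κ C : ℝ, 0 < κ ∧ ∀ m : ℕ, 1 ≤ m →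
      (bondPercolation (zdGraph 3) (criticalProbI 3)).real
          {ω | ω ∈ percolatesAt (0 : Site 3) ∧
            ∀ i : ℕ, 1 ≤ i → i ≤ m → ω ∉ percolatesAt (Pi.single 0 (i : ℤ) : Site 3)} ≤
        C * (m : ℝ) ^ (-(1 + κ)) := by
  unfold Summit.CriticalPhenomena.PercolationContinuityZ3.Theses.PercRayRenewal.JumpLineAvoidanceDecay at hG
  obtain ⟨κ, C, hκ, hC⟩ := hG hθ
  set P := bondPercolation (zdGraph 3) (criticalProbI 3) with hP
  set u : ℕ → ℝ := fun j => P.real {ω | ω ∈ percolatesAt (0 : Site 3) ∧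
    ∀ i : ℕ, 1 ≤ i → i ≤ j → ω ∉ percolatesAt (Pi.single 0 (i : ℤ) : Site 3)} with hu
  set e : ℕ → ℝ := fun j => P.real {ω : BondConfig (Site 3) | ∀ i : ℕ, 1 ≤ i → i ≤ j →
    ω ∉ percolatesAt (Pi.single 0 (i : ℤ) : Site 3)} with he
  have hC0 : 0 ≤ C := by
    have h1 := hC 1 le_rfl
    simp only [Nat.cast_one, Real.one_rpow, mul_one] at h1
    exact le_trans measureReal_nonneg h1
  refine ⟨κ, C * (2 : ℝ) ^ (1 + κ), hκ, fun m hm => ?_⟩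
  show u m ≤ C * (2 : ℝ) ^ (1 + κ) * (m : ℝ) ^ (-(1 + κ))
  -- the half-way point `m'` and the number of terms `n`
  obtain ⟨m', hm'⟩ : ∃ m' : ℕ, m' = (m + 1) / 2 := ⟨_, rfl⟩
  have hm'1 : 1 ≤ m' := by omega
  have h2m' : m ≤ 2 * m' := by omega
  obtain ⟨n, hn⟩ : ∃ n : ℕ, n = m - m' + 1 := ⟨_, rfl⟩
  have hmn : m' + n = m + 1 := by omega
  have h2n : m + 1 ≤ 2 * n := by omega
  have hm0 : (0 : ℝ) < m := by exact_mod_cast hm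
  have hn0 : (0 : ℝ) < n := by exact_mod_cast (show 0 < n by omega)
  have hm'0 : (0 : ℝ) < m' := by exact_mod_cast hm'1
  -- `n u_m ≤ e_{m'} - e_{m'+n} ≤ C m'^{-κ}`
  have hanti : ∀ j ∈ Finset.range n, u m ≤ u (m' + j) := fun j hj =>
    measureReal_mono (RayRenewal.vac_antitone (by have := Finset.mem_range.1 hj; omega))
      (measure_ne_top _ _)
  have hsum : ∑ j ∈ Finset.range n, u (m' + j) = e m' - e (m' + n) := sum_real_vac_eq m' n
  have h1 : (n : ℝ) * u m ≤ C * (m' : ℝ) ^ (-κ) := by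
    have hen : 0 ≤ e (m' + n) := measureReal_nonneg
    calc (n : ℝ) * u m = ∑ _j ∈ Finset.range n, u m := by
          rw [Finset.sum_const, Finset.card_range, nsmul_eq_mul]
      _ ≤ ∑ j ∈ Finset.range n, u (m' + j) := Finset.sum_le_sum hanti
      _ = e m' - e (m' + n) := hsum
      _ ≤ e m' := by linarith
      _ ≤ C * (m' : ℝ) ^ (-κ) := hC m' hm'1
  have h2 : u m ≤ C * (m' : ℝ) ^ (-κ) * (1 / n) := by
    rw [← div_eq_mul_one_div, le_div_iff₀ hn0, mul_comm]
    exact h1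
  -- `m'^{-κ} ≤ 2^κ m^{-κ}` and `1/n ≤ 2/m`
  have hA : (m' : ℝ) ^ (-κ) ≤ (2 : ℝ) ^ κ * (m : ℝ) ^ (-κ) := by
    have hle : (m : ℝ) / 2 ≤ m' := by
      rw [div_le_iff₀ (by norm_num : (0 : ℝ) < 2)]
      exact_mod_cast (by omega : m ≤ m' * 2)
    calc (m' : ℝ) ^ (-κ) ≤ ((m : ℝ) / 2) ^ (-κ) :=
          Real.rpow_le_rpow_of_nonpos (by positivity) hle (by linarith)
      _ = (m : ℝ) ^ (-κ) / (2 : ℝ) ^ (-κ) := Real.div_rpow hm0.le (by norm_num) _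
      _ = (2 : ℝ) ^ κ * (m : ℝ) ^ (-κ) := by
          rw [Real.rpow_neg (by norm_num : (0 : ℝ) ≤ 2), div_inv_eq_mul, mul_comm]
  have hB : 1 / (n : ℝ) ≤ 2 / m := by
    rw [div_le_div_iff₀ hn0 hm0, one_mul]
    exact_mod_cast (by omega : m ≤ 2 * n)
  have hpow : (2 : ℝ) ^ κ * (m : ℝ) ^ (-κ) * (2 / m) = (2 : ℝ) ^ (1 + κ) * (m : ℝ) ^ (-(1 + κ)) := by
    rw [Real.rpow_add (by norm_num : (0 : ℝ) < 2), Real.rpow_one, neg_add,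
      Real.rpow_add hm0, Real.rpow_neg_one]
    field_simp
  calc u m ≤ C * (m' : ℝ) ^ (-κ) * (1 / n) := h2
    _ ≤ C * ((2 : ℝ) ^ κ * (m : ℝ) ^ (-κ)) * (2 / m) :=
        mul_le_mul (mul_le_mul_of_nonneg_left hA hC0) hB (by positivity) (by positivity)
    _ = C * (2 : ℝ) ^ (1 + κ) * (m : ℝ) ^ (-(1 + κ)) := by
        rw [mul_assoc, hpow, mul_assoc]

/-- **Palm decay ⇒ G.** If `u_m ≤ C m^{-(1+κ)}` (`m ≥ 1`) in the jump world then
`e_m ≤ C (1 + 1/κ) m^{-κ}`: for every `n`, `e_m = (u_m + ⋯ + u_{m+n-1}) + e_{m+n}`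
(`sum_real_vac_eq`) `≤ C (1 + 1/κ) m^{-κ} + e_{m+n}` (`sum_rpow_neg_le`), and `e_{m+n} → 0`
(`tendsto_real_lineVac`, ergodicity). [folklore] -/
theorem jumpLineAvoidanceDecay_of_palmDecay
    (h : 0 < theta (zdGraph 3) (0 : Site 3) (criticalProbI 3) → ∃ κ C : ℝ, 0 < κ ∧ ∀ m : ℕ, 1 ≤ m →
      (bondPercolation (zdGraph 3) (criticalProbI 3)).real
          {ω | ω ∈ percolatesAt (0 : Site 3) ∧
            ∀ i : ℕ, 1 ≤ i → i ≤ m → ω ∉ percolatesAt (Pi.single 0 (i : ℤ) : Site 3)} ≤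
        C * (m : ℝ) ^ (-(1 + κ))) :
    Summit.CriticalPhenomena.PercolationContinuityZ3.Theses.PercRayRenewal.JumpLineAvoidanceDecay := by
  unfold Summit.CriticalPhenomena.PercolationContinuityZ3.Theses.PercRayRenewal.JumpLineAvoidanceDecay
  intro hθ
  obtain ⟨κ, C, hκ, hC⟩ := h hθ
  set P := bondPercolation (zdGraph 3) (criticalProbI 3) with hP
  set u : ℕ → ℝ := fun j => P.real {ω | ω ∈ percolatesAt (0 : Site 3) ∧
    ∀ i : ℕ, 1 ≤ i → i ≤ j → ω ∉ percolatesAt (Pi.single 0 (i : ℤ) : Site 3)} with hu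
  set e : ℕ → ℝ := fun j => P.real {ω : BondConfig (Site 3) | ∀ i : ℕ, 1 ≤ i → i ≤ j →
    ω ∉ percolatesAt (Pi.single 0 (i : ℤ) : Site 3)} with he
  have hC0 : 0 ≤ C := by
    have h1 := hC 1 le_rfl
    simp only [Nat.cast_one, Real.one_rpow, mul_one] at h1
    exact le_trans measureReal_nonneg h1
  refine ⟨κ, C * (1 + 1 / κ), hκ, fun m hm => ?_⟩
  show e m ≤ C * (1 + 1 / κ) * (m : ℝ) ^ (-κ)
  -- the bound with the remainder `e_{m+n}`
  have hbound : ∀ n : ℕ, e m ≤ C * (1 + 1 / κ) * (m : ℝ) ^ (-κ) + e (m + n) := by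
    intro n
    have hs : ∑ j ∈ Finset.range n, u (m + j) = e m - e (m + n) := sum_real_vac_eq m n
    have hle : ∑ j ∈ Finset.range n, u (m + j) ≤
        ∑ j ∈ Finset.range n, C * ((m : ℝ) + j) ^ (-(1 + κ)) := by
      refine Finset.sum_le_sum fun j _ => ?_
      have := hC (m + j) (by omega)
      push_cast at this
      exact this
    rw [← Finset.mul_sum] at hle
    have htail := mul_le_mul_of_nonneg_left (sum_rpow_neg_le hκ hm n) hC0
    linarith
  -- and `e_{m+n} → 0`
  have htend : Tendsto (fun n : ℕ => e (m + n)) atTop (𝓝 0) :=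
    (tendsto_real_lineVac hθ).comp (tendsto_atTop_mono (fun n => Nat.le_add_left n m) tendsto_id)
  refine le_of_forall_pos_le_add fun ε hε => ?_
  obtain ⟨n, hn⟩ : ∃ n : ℕ, e (m + n) < ε := (htend.eventually (gt_mem_nhds hε)).exists
  linarith [hbound n]

/-- **The Palm form of the crux G.** `JumpLineAvoidanceDecay` (in the jump world
`θ(p_c(ℤ³)) > 0`, `P_{p_c}(e₀ ↮ ∞, …, m e₀ ↮ ∞) ≤ C m^{-κ}` for some `κ > 0`) holds if and only
if, in the jump world, `P_{p_c}(0 ↔ ∞, e₀ ↮ ∞, …, m e₀ ↮ ∞) ≤ C m^{-(1+κ)}` for some `κ > 0`: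
the crux is exactly a power improvement of the Kac bound `(m+1) P_{p_c}(0 ↔ ∞, e₀ ↮ ∞, …,
m e₀ ↮ ∞) ≤ 1` (`real_vac_mul_le_one`), i.e. a Palm gap moment of order `1 + κ` for the
stationary point process of axis sites in infinite clusters. [folklore] -/
theorem jumpLineAvoidanceDecay_iff_palmDecay :
    Summit.CriticalPhenomena.PercolationContinuityZ3.Theses.PercRayRenewal.JumpLineAvoidanceDecay ↔
      (0 < theta (zdGraph 3) (0 : Site 3) (criticalProbI 3) → ∃ κ C : ℝ, 0 < κ ∧ ∀ m : ℕ, 1 ≤ m →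
        (bondPercolation (zdGraph 3) (criticalProbI 3)).real
            {ω | ω ∈ percolatesAt (0 : Site 3) ∧
              ∀ i : ℕ, 1 ≤ i → i ≤ m → ω ∉ percolatesAt (Pi.single 0 (i : ℤ) : Site 3)} ≤
          C * (m : ℝ) ^ (-(1 + κ))) :=
  ⟨palmDecay_of_jumpLineAvoidanceDecay, jumpLineAvoidanceDecay_of_palmDecay⟩

end Summit.CriticalPhenomena.PercolationContinuityZ3.Theorems

end
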